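import Mathlib.MeasureTheory.Measure.HasOuterApproxClosed
import Literature.Analysis.FunctionSpaces.TorusRieszFischerParam
import Literature.Analysis.FunctionSpaces.TorusSobolevNorm
import Literature.Analysis.FunctionSpaces.TorusSobolevNormFacts
import Literature.Analysis.FunctionSpaces.TorusVectorParseval
import HarnessLib

/-!
# `H⁰(T^d) = L²(T^d)`: uniqueness of Fourier coefficients, Riesz–Fischer and Plancherel

Discharges of the three `L²` named facts of `Literature.Analysis.FunctionSpaces.TorusSobolevNorm`
for a complete inner-product target `F`:

* `Torus.MemSobolev.memLp_two_holds` — `f ∈ H^s(T^d; F)`, `0 ≤ s` ⟹ `f ∈ L²`;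
* `Torus.eSobolevNorm_zero_eq_eLpNorm_holds` — `‖f‖_{H⁰} = ‖f‖_{L²}` in `[0, ∞]` for integrable `f`;
* `Torus.memSobolev_zero_iff_holds` — `MemSobolev 0 f ↔ MemLp f 2`,

by the textbook route of Grafakos 2014, §3.2 (everything below is proved):

* `Literature.Analysis.FunctionSpaces.ae_eq_zero_of_forall_integral_continuous_smul_eq_zero` — an integrable function (Borel
  measure on a pseudo-metrisable space, or any `HasOuterApproxClosed` space) whose integrals
  against all continuous real test functions vanish is `0` a.e. (closed sets have indicators that
  are pointwise limits of continuous functions with values in `[0, 1]`, Mathlib's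
  `IsClosed.apprSeq`; dominated convergence; then Mathlib's
  `MeasureTheory.ae_eq_zero_of_forall_setIntegral_isClosed_eq_zero`);
* `Literature.Analysis.FunctionSpaces.orthogonalFamily_span_singleton`, `Literature.Analysis.FunctionSpaces.summable_of_pairwise_inner_eq_zero`,
  `Literature.Analysis.FunctionSpaces.norm_sum_sq_of_pairwise_inner_eq_zero` — Mathlib's `OrthogonalFamily` API
  (`summable_iff_norm_sq_summable`, `norm_sum`) repackaged for a pairwise orthogonal *system of
  vectors* (the lines they span);
* `Torus.ae_eq_zero_of_forall_mFourierCoeff_eq_zero`, `Torus.ae_eq_of_forall_mFourierCoeff_eq` —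
  **uniqueness of Fourier coefficients in `L¹(T^d; F)`** (Grafakos 2014, Prop. 3.2.4, PDF
  p. 194: `f, g ∈ L¹(Tⁿ)`, `f̂ = ĝ` ⟹ `f = g` a.e.). Grafakos proves it with the Fejér kernel;
  here: `φ ↦ ∫ φ • f` is a sup-norm-continuous functional on `C(T^d, ℂ)` vanishing on the
  characters, hence on their dense span (Stone–Weierstrass,
  `UnitAddTorus.span_mFourier_closure_eq_top`), hence everywhere, and the first lemma applies;
* `Torus.exists_hasSum_toLp_mFourier_smul`,
  `Torus.exists_memLp_two_forall_mFourierCoeff_eq_of_summable` — **Riesz–Fischer with values in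
  a Hilbert space `F`** (Grafakos 2014, Prop. 3.2.7 (4), PDF
  p. 196: every square-summable sequence is the coefficient sequence of an `L²` function, whose
  squared norm is the sum of the squares): the elementary tensors `e_k • a_k` are pairwise
  orthogonal in the Hilbert space `L²(T^d; F)` (`Torus.inner_toLp_mFourier_smul`) with
  `‖e_k • a_k‖ = ‖a_k‖`, hence summable, and the coefficients of the sum are read off by testing
  against `e_l • b` (`Torus.inner_toLp_mFourier_smul_left`; same architecture as the scalar
  parametrised version `Torus.exists_memLp_two_forall_mFourierCoeff_eq` of
  `TorusRieszFischerParam`);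
* `Torus.sum_sq_norm_mFourierCoeff_le_norm_sq` (Bessel),
  `Torus.hasSum_sq_norm_mFourierCoeff_norm_sq`, `Torus.tsum_enorm_sq_mFourierCoeff_eq_eLpNorm_sq`
  — **Plancherel in `L²(T^d; F)`**
  (Grafakos 2014, Prop. 3.2.7 (1), PDF p. 195): Bessel ⟹ summability, Riesz–Fischer ⟹ an `L²` sum
  with the same coefficients and the right norm, uniqueness ⟹ it is the given function;
* `Torus.MemSobolev.memLp_two_of_zero` (`H⁰ ⊆ L²`) and the three discharges.

## Mathlib search

Mathlib has uniqueness of Fourier coefficients only inside `L²` (injectivity of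
`UnitAddTorus.mFourierBasis.repr`) and for continuous functions with summable coefficients
(`UnitAddTorus.hasSum_mFourier_series_of_summable`); nothing for `L¹` (searched
`mFourierCoeff.*eq_zero`, `ae_eq.*mFourierCoeff`). Its Parseval
`UnitAddTorus.hasSum_sq_mFourierCoeff` is scalar (`Lp ℂ 2`); there is no vector-valued
Plancherel/Riesz–Fischer on `UnitAddTorus`
(searched `mFourierBasis`, `hasSum_sq_mFourierCoeff`). It has the test-function lemma only for
smooth test functions on finite-dimensional real manifolds
(`ae_eq_zero_of_integral_contMDiff_smul_eq_zero`), not for continuous ones (searched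
`ae_eq_zero_of_integral`, `forall_integral.*smul`). The tree has the `L²` uniqueness
`Torus.ae_eq_of_mFourierCoeff_complexify_eq` (`FluidPDE/NSHopfLimit`), scalar / real-vector
Parseval (`TorusVectorParseval`) and scalar / `ℂ^d`-valued Riesz–Fischer
(`TorusRieszFischerParam`, `TorusSpaceTimeFields`), not the `F`-valued forms.

## References

* L. Grafakos, *Classical Fourier Analysis*, 3rd ed., GTM 249 (Springer 2014), Prop. 3.2.4
  (PDF p. 194, uniqueness of Fourier coefficients in `L¹(Tⁿ)`), Prop. 3.2.6–3.2.7 (1), (4)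
  (PDF pp. 195–196, complete orthonormal systems, Plancherel and Riesz–Fischer on `Tⁿ`).
  [Grafakos2014]
-/

open MeasureTheory Set Filter Topology UnitAddTorus
open scoped ENNReal NNReal ComplexConjugate InnerProductSpace

noncomputable section

namespace Literature.Analysis.FunctionSpaces

/-! ## Continuous test functions determine integrable functions -/

section TestContinuous

variable {X : Type*} [TopologicalSpace X] [MeasurableSpace X] [BorelSpace X]
  [HasOuterApproxClosed X] {μ : Measure X}
  {E : Type*} [NormedAddCommGroup E] [NormedSpace ℝ E] [CompleteSpace E]

/-- **Continuous test functions determine integrable functions.** On a topological space in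
which indicators of closed sets are pointwise limits of continuous `[0,1]`-valued functions
(`HasOuterApproxClosed`, e.g. any pseudo-metrisable space) with a Borel measure `μ`, an
integrable `f : X → E` (complete `E`) with `∫ g • f dμ = 0` for every continuous `g : X → ℝ`
vanishes `μ`-a.e.: by dominated convergence along `IsClosed.apprSeq` (dominated by `‖f‖`),
`∫_s f = 0` for every closed `s`, and Mathlib's
`ae_eq_zero_of_forall_setIntegral_isClosed_eq_zero` concludes (du Bois-Reymond lemma with
continuous test functions; the measure-theoretic step behind Grafakos 2014, Prop. 3.2.4).
[folklore] -/
theorem ae_eq_zero_of_forall_integral_continuous_smul_eq_zero {f : X → E} (hf : Integrable f μ)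
    (h : ∀ g : X → ℝ, Continuous g → ∫ x, g x • f x ∂μ = 0) : f =ᵐ[μ] 0 := by
  refine ae_eq_zero_of_forall_setIntegral_isClosed_eq_zero hf fun s hs => ?_
  -- continuous `g_n : X → [0, 1]` converging pointwise to `1_s`
  have hgc : ∀ n : ℕ, Continuous fun x => (hs.apprSeq n x : ℝ) := fun n =>
    NNReal.continuous_coe.comp (hs.apprSeq n).continuous
  have hlim : Tendsto (fun n : ℕ => ∫ x, (hs.apprSeq n x : ℝ) • f x ∂μ) atTop
      (𝓝 (∫ x, s.indicator f x ∂μ)) := by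
    refine tendsto_integral_of_dominated_convergence (fun x => ‖f x‖)
      (fun n => (hgc n).aestronglyMeasurable.smul hf.1) hf.norm
      (fun n => ae_of_all _ fun x => ?_) (ae_of_all _ fun x => ?_)
    · rw [norm_smul, Real.norm_of_nonneg (NNReal.coe_nonneg _)]
      exact mul_le_of_le_one_left (norm_nonneg _)
        (by exact_mod_cast HasOuterApproxClosed.apprSeq_apply_le_one hs n x)
    · have hx := tendsto_pi_nhds.1 (HasOuterApproxClosed.tendsto_apprSeq hs) x
      have hind : s.indicator f x = ((s.indicator (fun _ => (1 : ℝ≥0)) x : ℝ≥0) : ℝ) • f x := by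
        by_cases hxs : x ∈ s <;> simp [hxs]
      rw [hind]
      exact ((NNReal.continuous_coe.tendsto _).comp hx).smul tendsto_const_nhds
  have h0 : (fun n : ℕ => ∫ x, (hs.apprSeq n x : ℝ) • f x ∂μ) = fun _ => 0 :=
    funext fun n => h _ (hgc n)
  rw [h0, integral_indicator hs.measurableSet] at hlim
  exact (tendsto_const_nhds_iff.1 hlim).symm

end TestContinuous

/-! ## Orthogonal families of lines -/

section Lines

variable {𝕜 E ι : Type*} [RCLike 𝕜] [NormedAddCommGroup E] [InnerProductSpace 𝕜 E]

/-- Pairwise orthogonal vectors `X k` span an orthogonal family of lines `𝕜 ∙ X k` (the form in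
which Mathlib's `OrthogonalFamily` API — `OrthogonalFamily.summable_iff_norm_sq_summable`,
`OrthogonalFamily.norm_sum` — applies to an orthogonal *system of vectors*). [folklore] -/
theorem orthogonalFamily_span_singleton {X : ι → E} (h : Pairwise fun k l => ⟪X k, X l⟫_𝕜 = 0) :
    OrthogonalFamily 𝕜 (fun k => ↥(𝕜 ∙ X k)) fun k => (𝕜 ∙ X k).subtypeₗᵢ := by
  intro k l hkl v w
  obtain ⟨c, hc⟩ := Submodule.mem_span_singleton.1 v.2
  obtain ⟨c', hc'⟩ := Submodule.mem_span_singleton.1 w.2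
  simp only [Submodule.coe_subtypeₗᵢ, Submodule.coe_subtype, ← hc, ← hc', inner_smul_left,
    inner_smul_right, h hkl, mul_zero]

/-- For pairwise orthogonal vectors, `∑ X k` is summable iff `∑ ‖X k‖² < ∞`
(`OrthogonalFamily.summable_iff_norm_sq_summable` for the lines `𝕜 ∙ X k`). [folklore] -/
theorem summable_of_pairwise_inner_eq_zero [CompleteSpace E] {X : ι → E}
    (h : Pairwise fun k l => ⟪X k, X l⟫_𝕜 = 0) (hX : Summable fun k => ‖X k‖ ^ 2) :
    Summable X := by
  have h' := ((orthogonalFamily_span_singleton h).summable_iff_norm_sq_summable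
    (fun k => (⟨X k, Submodule.mem_span_singleton_self _⟩ : ↥(𝕜 ∙ X k)))).2 (by simpa using hX)
  simpa using h'

/-- Pythagoras for pairwise orthogonal vectors: `‖∑_{k ∈ S} X k‖² = ∑_{k ∈ S} ‖X k‖²`
(`OrthogonalFamily.norm_sum` for the lines `𝕜 ∙ X k`). [folklore] -/
theorem norm_sum_sq_of_pairwise_inner_eq_zero {X : ι → E}
    (h : Pairwise fun k l => ⟪X k, X l⟫_𝕜 = 0) (S : Finset ι) :
    ‖∑ k ∈ S, X k‖ ^ 2 = ∑ k ∈ S, ‖X k‖ ^ 2 := by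
  simpa using (orthogonalFamily_span_singleton h).norm_sum
    (fun k => (⟨X k, Submodule.mem_span_singleton_self _⟩ : ↥(𝕜 ∙ X k))) S

end Lines

namespace Torus

variable {d : Type*} [Fintype d]

/-! ## Uniqueness of Fourier coefficients in `L¹(T^d; F)` (Grafakos 2014, Prop. 3.2.4) -/

section Uniqueness

variable {F : Type*} [NormedAddCommGroup F] [NormedSpace ℂ F]

/-- `φ • f` is integrable for continuous `φ : T^d → ℂ` and integrable `f` (`‖φ x‖ ≤ ‖φ‖_∞`,
Mathlib `Integrable.bdd_smul`). [folklore] -/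
theorem integrable_continuousMap_smul (φ : C(UnitAddTorus d, ℂ)) {f : UnitAddTorus d → F}
    (hf : Integrable f volume) : Integrable (fun x => φ x • f x) volume :=
  hf.bdd_smul ‖φ‖ φ.continuous.aestronglyMeasurable (ae_of_all _ (φ.norm_coe_le_norm))

/-- `𝓕(-f)(k) = -𝓕f(k)` (no integrability needed). [folklore] -/
theorem mFourierCoeff_neg (f : UnitAddTorus d → F) (k : d → ℤ) :
    mFourierCoeff (-f) k = -mFourierCoeff f k := by
  simp [mFourierCoeff, integral_neg]

/-- The `H⁰` norm unfolded: all weights `⟨k⟩⁰` are one, so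
`‖f‖_{H⁰} = (∑_k ‖f̂(k)‖²)^{1/2}`. [folklore] -/
theorem eSobolevNorm_zero_eq_rpow_tsum (f : UnitAddTorus d → F) :
    eSobolevNorm 0 f = (∑' k, ‖mFourierCoeff f k‖ₑ ^ 2) ^ (1 / 2 : ℝ) := by
  simp only [eSobolevNorm, sobolevWeight_zero, one_pow, ENNReal.ofReal_one, one_mul]

variable [CompleteSpace F]

/-- **Uniqueness of Fourier coefficients in `L¹(T^d)`** (Grafakos 2014, Prop. 3.2.4, PDF p. 194,
case `g = 0`, with values in a complex Banach space `F`): if `f ∈ L¹(T^d; F)` has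
`f̂(k) = 0` for all `k ∈ ℤ^d`, then `f = 0` a.e. Proof here: the functional `φ ↦ ∫ φ • f` on
`C(T^d, ℂ)` is Lipschitz for the sup norm, vanishes on the characters `e_n` (its value there is
`f̂(-n)`), hence on their span and, by density of trigonometric polynomials
(`UnitAddTorus.span_mFourier_closure_eq_top`), on all of `C(T^d, ℂ)`; in particular on real
continuous test functions, so `f = 0` a.e. by
`Literature.Analysis.FunctionSpaces.ae_eq_zero_of_forall_integral_continuous_smul_eq_zero`. Completeness of `F` is needed (on a
non-complete target every Bochner integral is `0`). [cite: Grafakos2014, Prop. 3.2.4] -/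
theorem ae_eq_zero_of_forall_mFourierCoeff_eq_zero {f : UnitAddTorus d → F}
    (hf : Integrable f volume) (h : ∀ k, mFourierCoeff f k = 0) : f =ᵐ[volume] 0 := by
  -- `Λ φ := ∫ φ • f` (global volume) vanishes on the characters: `Λ e_n = f̂(-n)` (Mathlib's
  -- `mFourierCoeff` integrates against the local Haar volume, `Torus.volume_eq_pi_haarAddCircle`)
  have hchar : ∀ n : d → ℤ, ∫ x, mFourier n x • f x = 0 := fun n => by
    have hn : ∫ x, mFourier (- -n) x • f x = 0 :=
      (congrArg (fun μ : Measure (UnitAddTorus d) => ∫ x, mFourier (- -n) x • f x ∂μ)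
        (volume_eq_pi_haarAddCircle (d := d))).trans (h (-n))
    rwa [neg_neg] at hn
  -- hence on their linear span
  have hspan : ∀ φ ∈ Submodule.span ℂ (Set.range (mFourier (d := d))), ∫ x, φ x • f x = 0 := by
    intro φ hφ
    induction hφ using Submodule.span_induction with
    | mem φ hφ =>
        obtain ⟨n, rfl⟩ := hφ
        exact hchar n
    | zero => simp
    | add φ ψ _ _ h1 h2 =>
        simp only [ContinuousMap.add_apply, add_smul]
        rw [integral_add (integrable_continuousMap_smul φ hf) (integrable_continuousMap_smul ψ hf),
          h1, h2, add_zero]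
    | smul c φ _ h1 =>
        simp only [ContinuousMap.smul_apply, smul_eq_mul, mul_smul]
        rw [integral_smul, h1, smul_zero]
  -- `Λ` is Lipschitz with constant `‖f‖_{L¹}` for the sup norm, hence continuous
  have hcont : Continuous fun φ : C(UnitAddTorus d, ℂ) => ∫ x, φ x • f x := by
    refine (LipschitzWith.of_dist_le' (K := ∫ x, ‖f x‖) fun φ ψ => ?_).continuous
    rw [dist_eq_norm, dist_eq_norm,
      ← integral_sub (integrable_continuousMap_smul φ hf) (integrable_continuousMap_smul ψ hf)]
    calc ‖∫ x, (φ x • f x - ψ x • f x)‖ ≤ ∫ x, ‖φ - ψ‖ * ‖f x‖ :=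
          norm_integral_le_of_norm_le (hf.norm.const_mul _) (ae_of_all _ fun x => by
            rw [← sub_smul, norm_smul]
            exact mul_le_mul_of_nonneg_right ((φ - ψ).norm_coe_le_norm x) (norm_nonneg _))
      _ = (∫ x, ‖f x‖) * ‖φ - ψ‖ := by rw [integral_const_mul, mul_comm]
  -- the span is dense (Stone–Weierstrass), so `Λ = 0`
  have hdense : Dense (Submodule.span ℂ (Set.range (mFourier (d := d))) :
      Set C(UnitAddTorus d, ℂ)) :=
    Submodule.dense_iff_topologicalClosure_eq_top.2 span_mFourier_closure_eq_top
  have hall : ∀ φ : C(UnitAddTorus d, ℂ), ∫ x, φ x • f x = 0 := fun φ =>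
    closure_minimal (fun ψ hψ => hspan ψ hψ) (isClosed_eq hcont continuous_const) (hdense φ)
  -- in particular for real continuous test functions
  refine ae_eq_zero_of_forall_integral_continuous_smul_eq_zero hf fun g hg => ?_
  have hφ := hall ⟨fun x => (g x : ℂ), by fun_prop⟩
  simpa only [ContinuousMap.coe_mk, Complex.coe_smul] using hφ

/-- **Uniqueness of Fourier coefficients in `L¹(T^d)`**, as printed (Grafakos 2014, Prop. 3.2.4,
PDF p. 194; values in a complex Banach space `F`): if `f, g ∈ L¹(T^d; F)` satisfy `f̂(k) = ĝ(k)`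
for all `k ∈ ℤ^d`, then `f = g` a.e. ("by linearity of the problem, it suffices to assume that
`g = 0`": `ae_eq_zero_of_forall_mFourierCoeff_eq_zero` applied to `f - g`).
[cite: Grafakos2014, Prop. 3.2.4] -/
theorem ae_eq_of_forall_mFourierCoeff_eq {f g : UnitAddTorus d → F} (hf : Integrable f volume)
    (hg : Integrable g volume) (h : ∀ k, mFourierCoeff f k = mFourierCoeff g k) :
    f =ᵐ[volume] g := by
  have h0 := ae_eq_zero_of_forall_mFourierCoeff_eq_zero (hf.sub hg) fun k => by
    rw [sub_eq_add_neg, mFourierCoeff_add hf hg.neg, mFourierCoeff_neg, h k, add_neg_cancel]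
  filter_upwards [h0] with x hx
  simpa [sub_eq_zero] using hx

end Uniqueness

/-! ## Riesz–Fischer and Plancherel with values in a Hilbert space (Grafakos 2014, Prop. 3.2.7) -/

section RieszFischer

variable {F : Type*} [NormedAddCommGroup F] [InnerProductSpace ℂ F]

/-- The elementary tensor `x ↦ e_k(x) • a` lies in `L²(T^d; F)` (it is continuous with
`‖e_k(x) • a‖ = ‖a‖`). [folklore] -/
theorem memLp_mFourier_smul (k : d → ℤ) (a : F) :
    MemLp (fun x : UnitAddTorus d => mFourier k x • a) 2 volume :=
  MemLp.of_bound ((mFourier k).continuous.smul continuous_const).aestronglyMeasurable ‖a‖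
    (ae_of_all _ fun x => by rw [norm_smul, norm_mFourier_apply, one_mul])

/-- **Orthogonality of the elementary tensors** in `L²(T^d; F)`:
`⟪e_k • a, e_l • b⟫ = δ_{kl} ⟪a, b⟫` (orthonormality of the characters,
`Torus.integral_conj_mFourier_mul_mFourier`; Grafakos 2014, PDF p. 195).
[cite: Grafakos2014, Prop. 3.2.7] -/
theorem inner_toLp_mFourier_smul [DecidableEq (d → ℤ)] (k l : d → ℤ) (a b : F) :
    ⟪(memLp_mFourier_smul k a).toLp _, (memLp_mFourier_smul l b).toLp _⟫_ℂ =
      if k = l then ⟪a, b⟫_ℂ else 0 := by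
  have hae : (fun x : UnitAddTorus d =>
      ⟪((memLp_mFourier_smul k a).toLp _ : UnitAddTorus d → F) x,
        ((memLp_mFourier_smul l b).toLp _ : UnitAddTorus d → F) x⟫_ℂ) =ᵐ[volume]
      fun x => conj (mFourier k x) * mFourier l x * ⟪a, b⟫_ℂ := by
    filter_upwards [(memLp_mFourier_smul k a).coeFn_toLp, (memLp_mFourier_smul l b).coeFn_toLp]
      with x hx hx'
    rw [hx, hx', inner_smul_left, inner_smul_right, mul_assoc]
  rw [L2.inner_def, integral_congr_ae hae, integral_mul_const, integral_conj_mFourier_mul_mFourier]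
  split_ifs <;> simp

/-- The elementary tensors are pairwise orthogonal in `L²(T^d; F)`. [folklore] -/
theorem pairwise_inner_toLp_mFourier_smul_eq_zero (a : (d → ℤ) → F) :
    Pairwise fun k l => ⟪(memLp_mFourier_smul k (a k)).toLp (fun x : UnitAddTorus d =>
      mFourier k x • a k), (memLp_mFourier_smul l (a l)).toLp (fun x : UnitAddTorus d =>
      mFourier l x • a l)⟫_ℂ = 0 := by
  classical
  intro k l hkl
  rw [inner_toLp_mFourier_smul, if_neg hkl]

/-- `‖e_k • a‖_{L²} = ‖a‖` (the volume of `T^d` is one). [folklore] -/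
theorem norm_toLp_mFourier_smul (k : d → ℤ) (a : F) :
    ‖(memLp_mFourier_smul k a).toLp (fun x : UnitAddTorus d => mFourier k x • a)‖ = ‖a‖ := by
  classical
  have h : ‖(memLp_mFourier_smul k a).toLp (fun x : UnitAddTorus d => mFourier k x • a)‖ ^ 2 =
      ‖a‖ ^ 2 := by
    rw [← inner_self_eq_norm_sq (𝕜 := ℂ), inner_toLp_mFourier_smul, if_pos rfl,
      inner_self_eq_norm_sq]
  exact (pow_left_inj₀ (norm_nonneg _) (norm_nonneg _) two_ne_zero).1 h

variable [CompleteSpace F]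

/-- Testing an `L²` class against an elementary tensor reads off a Fourier coefficient:
`⟪e_l • b, g⟫_{L²} = ⟪b, ĝ(l)⟫_F` (`conj e_l = e_{-l}` and `∫ ⟪b, ·⟫ = ⟪b, ∫ ·⟫`). [folklore] -/
theorem inner_toLp_mFourier_smul_left (l : d → ℤ) (b : F)
    (g : Lp F 2 (volume : Measure (UnitAddTorus d))) :
    ⟪(memLp_mFourier_smul l b).toLp _, g⟫_ℂ = ⟪b, mFourierCoeff (g : UnitAddTorus d → F) l⟫_ℂ := by
  have hgi : Integrable (fun x => mFourier (-l) x • (g : UnitAddTorus d → F) x) volume :=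
    integrable_continuousMap_smul (mFourier (-l)) ((Lp.memLp g).integrable one_le_two)
  have hae : (fun x : UnitAddTorus d =>
      ⟪((memLp_mFourier_smul l b).toLp _ : UnitAddTorus d → F) x, (g : UnitAddTorus d → F) x⟫_ℂ)
      =ᵐ[volume] fun x => ⟪b, mFourier (-l) x • (g : UnitAddTorus d → F) x⟫_ℂ := by
    filter_upwards [(memLp_mFourier_smul l b).coeFn_toLp] with x hx
    rw [hx, inner_smul_left, inner_smul_right, mFourier_neg]
  rw [L2.inner_def, integral_congr_ae hae, integral_inner hgi]
  exact congrArg (fun c : F => ⟪b, c⟫_ℂ) (congrArg (fun μ : Measure (UnitAddTorus d) =>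
    ∫ x, mFourier (-l) x • (g : UnitAddTorus d → F) x ∂μ) (volume_eq_pi_haarAddCircle (d := d)))

/-- **Riesz–Fischer on `T^d` with values in a Hilbert space, `L²` form** (Grafakos 2014,
Prop. 3.2.7 (4) with (1), PDF pp. 195–196, for `F`-valued coefficients): for a square-summable
`a : ℤ^d → F` the series `∑_k e_k • a_k` converges in `L²(T^d; F)` to some `g` with `ĝ(k) = a_k`
for all `k` and `‖g‖²_{L²} = ∑_k ‖a_k‖²`. Proof: the tensors `e_k • a_k` are pairwise orthogonal
with `‖e_k • a_k‖ = ‖a_k‖`, hence summable (`Literature.Analysis.FunctionSpaces.summable_of_pairwise_inner_eq_zero`); the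
coefficients of the sum are identified by `⟪e_l • b, g⟫_{L²} = ⟪b, ĝ(l)⟫_F = ⟪b, a_l⟫_F` for all
`b ∈ F`, and `‖g‖² = ∑_k ⟪g, e_k • a_k⟫ = ∑_k ‖a_k‖²`. [cite: Grafakos2014, Prop. 3.2.7 (4)] -/
theorem exists_hasSum_toLp_mFourier_smul {a : (d → ℤ) → F} (ha : Summable fun k => ‖a k‖ ^ 2) :
    ∃ g : Lp F 2 (volume : Measure (UnitAddTorus d)),
      HasSum (fun k => (memLp_mFourier_smul k (a k)).toLp (fun x : UnitAddTorus d =>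
        mFourier k x • a k)) g ∧
      (∀ k, mFourierCoeff (g : UnitAddTorus d → F) k = a k) ∧
      HasSum (fun k => ‖a k‖ ^ 2) (‖g‖ ^ 2) := by
  classical
  -- the elementary tensors `e_k • a_k` as elements of `L²(T^d; F)`
  set X : (d → ℤ) → Lp F 2 (volume : Measure (UnitAddTorus d)) :=
    fun k => (memLp_mFourier_smul k (a k)).toLp _ with hX
  have horth : Pairwise fun k l => ⟪X k, X l⟫_ℂ = 0 := pairwise_inner_toLp_mFourier_smul_eq_zero a
  have hnorm : ∀ k, ‖X k‖ = ‖a k‖ := fun k => norm_toLp_mFourier_smul k (a k)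
  have hsum : Summable X :=
    summable_of_pairwise_inner_eq_zero horth (by simpa only [hnorm] using ha)
  set g : Lp F 2 (volume : Measure (UnitAddTorus d)) := ∑' k, X k with hg_def
  have hg : HasSum X g := hsum.hasSum
  -- coefficients: test against `e_l • b`, `b ∈ F`
  have hcoeff : ∀ l, mFourierCoeff (g : UnitAddTorus d → F) l = a l := fun l => by
    refine ext_inner_left ℂ fun b => ?_
    have hs : HasSum (fun k => ⟪(memLp_mFourier_smul l b).toLp _, X k⟫_ℂ)
        ⟪(memLp_mFourier_smul l b).toLp _, g⟫_ℂ := by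
      simpa only [innerSL_apply_apply] using
        hg.mapL (innerSL ℂ ((memLp_mFourier_smul l b).toLp _))
    have hyX : ∀ k, ⟪(memLp_mFourier_smul l b).toLp _, X k⟫_ℂ =
        if k = l then ⟪b, a l⟫_ℂ else 0 := fun k => by
      rw [hX, inner_toLp_mFourier_smul l k b (a k)]
      by_cases hkl : k = l
      · simp [hkl]
      · rw [if_neg (Ne.symm hkl), if_neg hkl]
    simp_rw [hyX] at hs
    rw [← inner_toLp_mFourier_smul_left, hs.unique (hasSum_ite_eq l _)]
  refine ⟨g, hg, hcoeff, ?_⟩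
  -- Plancherel for the sum: `‖g‖² = Re ⟪g, g⟫ = ∑_k Re ⟪g, X k⟫ = ∑_k ‖a k‖²`
  have hs : HasSum (fun k => ⟪g, X k⟫_ℂ) ⟪g, g⟫_ℂ := by
    simpa only [innerSL_apply_apply] using hg.mapL (innerSL ℂ g)
  have hs' : HasSum (fun k => (⟪g, X k⟫_ℂ).re) (⟪g, g⟫_ℂ).re := by
    simpa only [Complex.reCLM_apply] using hs.mapL Complex.reCLM
  have hgX : ∀ k, (⟪g, X k⟫_ℂ).re = ‖a k‖ ^ 2 := fun k => by
    rw [← inner_conj_symm, Complex.conj_re, hX, inner_toLp_mFourier_smul_left, hcoeff,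
      ← RCLike.re_to_complex, inner_self_eq_norm_sq]
  have hgg : (⟪g, g⟫_ℂ).re = ‖g‖ ^ 2 := by
    rw [← RCLike.re_to_complex, inner_self_eq_norm_sq]
  simp_rw [hgX, hgg] at hs'
  exact hs'

/-- **Riesz–Fischer on `T^d` with values in a Hilbert space** (Grafakos 2014, Prop. 3.2.7 (4),
PDF p. 196, for `F`-valued coefficients): every square-summable `a : ℤ^d → F` is the sequence of
Fourier coefficients of some function `g ∈ L²(T^d; F)`. [cite: Grafakos2014, Prop. 3.2.7 (4)] -/
theorem exists_memLp_two_forall_mFourierCoeff_eq_of_summable {a : (d → ℤ) → F}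
    (ha : Summable fun k => ‖a k‖ ^ 2) :
    ∃ g : UnitAddTorus d → F, MemLp g 2 volume ∧ ∀ k, mFourierCoeff g k = a k := by
  obtain ⟨g, -, hcoeff, -⟩ := exists_hasSum_toLp_mFourier_smul ha
  exact ⟨g, Lp.memLp g, hcoeff⟩

/-- **Bessel's inequality in `L²(T^d; F)`**: `∑_{k ∈ S} ‖ĝ(k)‖² ≤ ‖g‖²_{L²}` for every finite
`S ⊆ ℤ^d` (expand `0 ≤ ‖g - ∑_{k ∈ S} e_k • ĝ(k)‖²` using `⟪e_k • ĝ(k), g⟫ = ‖ĝ(k)‖²` and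
Pythagoras for the pairwise orthogonal tensors; the Hilbert-space inequality behind
Grafakos 2014, Prop. 3.2.6, for the orthogonal system `{e_k • a}`). [folklore] -/
theorem sum_sq_norm_mFourierCoeff_le_norm_sq (g : Lp F 2 (volume : Measure (UnitAddTorus d)))
    (S : Finset (d → ℤ)) :
    ∑ k ∈ S, ‖mFourierCoeff (g : UnitAddTorus d → F) k‖ ^ 2 ≤ ‖g‖ ^ 2 := by
  classical
  set a : (d → ℤ) → F := fun k => mFourierCoeff (g : UnitAddTorus d → F) k with ha
  set X : (d → ℤ) → Lp F 2 (volume : Measure (UnitAddTorus d)) :=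
    fun k => (memLp_mFourier_smul k (a k)).toLp _ with hX
  have horth : Pairwise fun k l => ⟪X k, X l⟫_ℂ = 0 := pairwise_inner_toLp_mFourier_smul_eq_zero a
  set P : Lp F 2 (volume : Measure (UnitAddTorus d)) := ∑ k ∈ S, X k with hP
  have hXg : ∀ k, ⟪X k, g⟫_ℂ = ((‖a k‖ ^ 2 : ℝ) : ℂ) := fun k => by
    rw [hX, inner_toLp_mFourier_smul_left, inner_self_eq_norm_sq_to_K]
    norm_cast
  have hPg : ⟪g, P⟫_ℂ = ((∑ k ∈ S, ‖a k‖ ^ 2 : ℝ) : ℂ) := by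
    rw [← inner_conj_symm, hP, sum_inner]
    simp_rw [hXg]
    rw [← Complex.ofReal_sum, Complex.conj_ofReal]
  have hPP : ‖P‖ ^ 2 = ∑ k ∈ S, ‖a k‖ ^ 2 := by
    rw [hP, norm_sum_sq_of_pairwise_inner_eq_zero horth S]
    exact Finset.sum_congr rfl fun k _ => by rw [hX, norm_toLp_mFourier_smul]
  have h0 : 0 ≤ ‖g - P‖ ^ 2 := sq_nonneg _
  rw [@norm_sub_sq ℂ, hPg, hPP, RCLike.re_to_complex, Complex.ofReal_re] at h0
  linarith

/-- **Plancherel's identity in `L²(T^d; F)`** (Grafakos 2014, Prop. 3.2.7 (1), PDF p. 195, for a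
Hilbert-space target `F`): `‖g‖²_{L²} = ∑_k ‖ĝ(k)‖²` as a `HasSum`. Proof: Bessel gives the
summability of `‖ĝ(k)‖²`; Riesz–Fischer (`exists_hasSum_toLp_mFourier_smul`) produces
`g' = ∑_k e_k • ĝ(k)` with the same coefficients and `‖g'‖² = ∑_k ‖ĝ(k)‖²`, and uniqueness of
Fourier coefficients in `L¹ ⊇ L²` (Prop. 3.2.4) gives `g = g'`. Mathlib has the scalar case
(`UnitAddTorus.hasSum_sq_mFourierCoeff`). [cite: Grafakos2014, Prop. 3.2.7 (1)] -/
theorem hasSum_sq_norm_mFourierCoeff_norm_sq (g : Lp F 2 (volume : Measure (UnitAddTorus d))) :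
    HasSum (fun k => ‖mFourierCoeff (g : UnitAddTorus d → F) k‖ ^ 2) (‖g‖ ^ 2) := by
  have hsum : Summable fun k => ‖mFourierCoeff (g : UnitAddTorus d → F) k‖ ^ 2 :=
    summable_of_sum_le (fun k => sq_nonneg _) (sum_sq_norm_mFourierCoeff_le_norm_sq g)
  obtain ⟨g', -, hcoeff, hP⟩ := exists_hasSum_toLp_mFourier_smul hsum
  have hgg' : g = g' :=
    Lp.ext (ae_eq_of_forall_mFourierCoeff_eq ((Lp.memLp g).integrable one_le_two)
      ((Lp.memLp g').integrable one_le_two) fun k => (hcoeff k).symm)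
  have hn : ‖g‖ = ‖g'‖ := by rw [hgg']
  rw [hn]
  exact hP

/-- **Plancherel for `L²` functions on `T^d` with values in a Hilbert space**, in `[0, ∞]`:
`∑_k ‖f̂(k)‖ₑ² = ‖f‖²_{L²}` for `f ∈ L²(T^d; F)` (honest function, global volume; Grafakos 2014,
Prop. 3.2.7 (1)). The scalar real-valued form is `Torus.hasSum_sq_norm_mFourierCoeff`
(`TorusVectorParseval`). [cite: Grafakos2014, Prop. 3.2.7 (1)] -/
theorem tsum_enorm_sq_mFourierCoeff_eq_eLpNorm_sq {f : UnitAddTorus d → F}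
    (hf : MemLp f 2 volume) :
    ∑' k, ‖mFourierCoeff f k‖ₑ ^ 2 = eLpNorm f 2 volume ^ 2 := by
  have h := hasSum_sq_norm_mFourierCoeff_norm_sq (hf.toLp f)
  have hc : ∀ k, mFourierCoeff (hf.toLp f : UnitAddTorus d → F) k = mFourierCoeff f k :=
    fun k => mFourierCoeff_congr_ae hf.coeFn_toLp k
  simp only [hc] at h
  rw [← Lp.enorm_toLp hf, ← ofReal_norm, ← ENNReal.ofReal_pow (norm_nonneg _), ← h.tsum_eq,
    ENNReal.ofReal_tsum_of_nonneg (fun k => sq_nonneg _) h.summable]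
  refine tsum_congr fun k => ?_
  rw [← ofReal_norm, ENNReal.ofReal_pow (norm_nonneg _)]

end RieszFischer

/-! ## `H⁰ ⊆ L²` and the discharge of `Torus.MemSobolev.memLp_two` -/

section L2

variable {F : Type*} [NormedAddCommGroup F] [InnerProductSpace ℂ F] [CompleteSpace F]

/-- **`H⁰(T^d; F) ⊆ L²(T^d; F)`** (the forward half of the named fact `Torus.memSobolev_zero_iff`;
Grafakos 2014, Prop. 3.2.7 (4) with Prop. 3.2.4): if `f` is integrable with
`∑_k ‖f̂(k)‖² < ∞`, Riesz–Fischer gives `g ∈ L²` with `ĝ = f̂`, and uniqueness of Fourier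
coefficients in `L¹` gives `f = g` a.e., so `f ∈ L²`.
[cite: Grafakos2014, Prop. 3.2.4 and Prop. 3.2.7 (4)] -/
theorem MemSobolev.memLp_two_of_zero {f : UnitAddTorus d → F} (hf : MemSobolev 0 f) :
    MemLp f 2 volume := by
  -- `∑_k ‖f̂(k)‖² < ∞` from `‖f‖_{H⁰} < ∞` (all weights are `1`)
  have hfin : ∑' k, ‖mFourierCoeff f k‖ₑ ^ 2 < ∞ := by
    have h := hf.2
    rw [eSobolevNorm_zero_eq_rpow_tsum] at h
    exact (ENNReal.rpow_lt_top_iff_of_pos (by positivity)).1 h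
  have hsum : Summable fun k => ‖mFourierCoeff f k‖ ^ 2 := by
    simpa using ENNReal.summable_toReal hfin.ne
  obtain ⟨g, hg, hcoeff⟩ := exists_memLp_two_forall_mFourierCoeff_eq_of_summable hsum
  have hae : f =ᵐ[volume] g :=
    ae_eq_of_forall_mFourierCoeff_eq hf.1 (hg.integrable one_le_two) fun k => (hcoeff k).symm
  exact hg.ae_eq hae.symm

/-- Discharge of the named fact `Torus.MemSobolev.memLp_two`: **`H^s(T^d; F) ⊆ L²(T^d; F)` for
`0 ≤ s`** and a complete inner-product target `F` (`H^s ⊆ H⁰` by monotonicity of the weights,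
`Torus.MemSobolev.mono`, and `H⁰ ⊆ L²`, `Torus.MemSobolev.memLp_two_of_zero`; Grafakos 2014,
Prop. 3.2.4 and Prop. 3.2.7 (4)).
[cite: Grafakos2014, Prop. 3.2.4 and Prop. 3.2.7 (4)] -/
theorem MemSobolev.memLp_two_holds : MemSobolev.memLp_two (d := d) (F := F) :=
  fun hf hs => (hf.mono hs).memLp_two_of_zero

/-- Discharge of the named fact `Torus.eSobolevNorm_zero_eq_eLpNorm`: **`‖f‖_{H⁰} = ‖f‖_{L²}` in
`[0, ∞]` for integrable `f`** and a complete inner-product target `F` (Grafakos 2014,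
Prop. 3.2.7 (1)). For `f ∈ L²` this is Plancherel (`tsum_enorm_sq_mFourierCoeff_eq_eLpNorm_sq`);
for integrable `f ∉ L²` both sides are `∞`, the left one because `‖f‖_{H⁰} < ∞` would put `f` in
`H⁰ ⊆ L²` (`MemSobolev.memLp_two_of_zero`). [cite: Grafakos2014, Prop. 3.2.7 (1)] -/
theorem eSobolevNorm_zero_eq_eLpNorm_holds : eSobolevNorm_zero_eq_eLpNorm (d := d) (F := F) := by
  intro f hf
  rw [eSobolevNorm_zero_eq_rpow_tsum]
  by_cases h2 : MemLp f 2 volume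
  · rw [tsum_enorm_sq_mFourierCoeff_eq_eLpNorm_sq h2, ← ENNReal.rpow_natCast, ← ENNReal.rpow_mul]
    norm_num
  · have hR : eLpNorm f 2 volume = ∞ := by
      by_contra hne
      exact h2 ⟨hf.aestronglyMeasurable, lt_top_iff_ne_top.2 hne⟩
    have hL : ¬(∑' k, ‖mFourierCoeff f k‖ₑ ^ 2) ^ (1 / 2 : ℝ) < ∞ := fun hlt =>
      h2 (MemSobolev.memLp_two_of_zero ⟨hf, by rwa [eSobolevNorm_zero_eq_rpow_tsum]⟩)
    rw [hR, not_lt_top_iff.1 hL]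

/-- Discharge of the named fact `Torus.memSobolev_zero_iff`: **`H⁰(T^d; F) = L²(T^d; F)`**, i.e.
`MemSobolev 0 f ↔ MemLp f 2` for every `f` and a complete inner-product target `F`
(`H⁰ ⊆ L²`: `MemSobolev.memLp_two_of_zero`, Grafakos 2014, Prop. 3.2.4 with 3.2.7 (4);
`L² ⊆ H⁰`: `L² ⊆ L¹` on the probability space `T^d` and Plancherel, Prop. 3.2.7 (1)).
[cite: Grafakos2014, Prop. 3.2.7 (1) and (4) with Prop. 3.2.4] -/
theorem memSobolev_zero_iff_holds : memSobolev_zero_iff (d := d) (F := F) := by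
  intro f
  refine ⟨MemSobolev.memLp_two_of_zero, fun hf => ⟨hf.integrable one_le_two, ?_⟩⟩
  rw [eSobolevNorm_zero_eq_eLpNorm_holds (hf.integrable one_le_two)]
  exact hf.2

end L2

end Torus

end Literature.Analysis.FunctionSpaces
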